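import Summits.QuantumFields.YangMills.Theorems.ColdStartUniversalityLatticeLangevinWilsonInvariant
import HarnessLib

/-!
# Route `ColdStartUniversality` (crux K_A1 stmt-QuantumFields-24809, line «cold_entropy», rung `stub_fixedCutoffEntropy`):
# UNIFORM EXPONENTIAL MIXING of the SU(2) lattice Langevin (SZZ) dynamics at a fixed cut-off, every coupling, every start

Helper file (seat `ym-line-csu-p1`, g10; `--supports stmt-QuantumFields-24809`).  The quantitative form of the tree's
`pointwiseMixing_of_harris` with all three inputs now theorems of the tree — Chapman–Kolmogorov (`chapmanKolmogorov_szz`),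
the Doeblin minorisation at every coupling (`doeblin_szz`) and SZZ Lemma 3.3 (`wilsonMeasureLangevinInvariant_su2`):

* `exp_mixing_szz` — for every torus size `L`, coupling `β'` there are `C, c > 0` with
  `|E f(U_t) − ∫ f dμ_W| ≤ C e^{−ct}` for EVERY deterministic start `z`, every lattice time `t`, every measurable `|f| ≤ 1`
  and every strong solution `U` from `z` on ANY probability space (uniform in the start: the Lyapunov function is `V ≡ 1`
  on the compact state space; Harris' theorem for Markov semigroups, `MarkovSemigroup.exp_convergence_of_drift_of_minorization`).
* `exp_mixing_szz_map` — the same bound read on the one-time law `law(U_t) = P.map (U t)`.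

THEOREMS ONLY, no sorry, standard axioms.  HONEST FRAMING: fixed-cut-off plumbing (constants depend on `L, β'`); nothing
here is uniform in the cut-off; no crux, rung-of-the-ladder or summit is proved; the Yang–Mills mass gap is NOT proved.
-/

set_option autoImplicit false

noncomputable section

namespace Summit.QuantumFields.YangMills.Theorems.ColdStartUniversality

open MeasureTheory ProbabilityTheory
open scoped NNReal ENNReal
open Literature.Probability.Process Literature.MathematicalPhysics.QuantumFieldTheory
open Literature.MathematicalPhysics.QuantumLattice (fundamentalRep fundamentalLatticeRep continuous_fundamentalRep)

variable (L : ℕ) [NeZero L]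

/-- ★ **Uniform exponential mixing of the SU(2) lattice Langevin dynamics at a fixed cut-off.**  For every torus size `L`
and coupling `β'` there are constants `C, c > 0` such that for EVERY start `z`, every lattice time `t`, every measurable
observable `|f| ≤ 1` and every strong solution `U` of the SZZ system from `z` on any probability space,
`|E f(U_t) − ∫ f dμ_W| ≤ C e^{−ct}` (`μ_W` the Wilson–Gibbs measure at `β'`).  Harris' theorem for the Markov semigroup of
THE transition kernels (`exists_transitionKernel`) with `V ≡ 1`: Chapman–Kolmogorov `chapmanKolmogorov_szz`, Doeblin
`doeblin_szz`, invariance `wilsonMeasureLangevinInvariant_su2`. [cite: HairerMattingly2011, Theorems 1.2 and 1.3]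
[cite: ShenZhuZhu2022, §3 Lemma 3.3 (p. 13)] -/
theorem exp_mixing_szz (β' : ℝ) :
    ∃ C c : ℝ, 0 < C ∧ 0 < c ∧
      ∀ (z : GaugeConfig 3 L (Matrix.specialUnitaryGroup (Fin 2) ℂ)) (t : ℝ≥0)
        (f : GaugeConfig 3 L (Matrix.specialUnitaryGroup (Fin 2) ℂ) → ℝ), Measurable f → (∀ y, |f y| ≤ 1) →
        ∀ (Ω : Type) [MeasurableSpace Ω] (P : Measure Ω) [IsProbabilityMeasure P]
          (W : ℝ≥0 → Ω → (Edge 3 L × NoiseIdx 2 → ℝ)) (hW : IsFlatBrownian W P)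
          (U : ℝ≥0 → Ω → GaugeConfig 3 L (Matrix.specialUnitaryGroup (Fin 2) ℂ)),
          (∀ ω, U 0 ω = z) →
          (latticeLangevinDynamics (fundamentalLatticeRep 2) β').IsSolution (fundamentalRep (Fin 2))
            hW.natFiltration P W U →
          |(∫ ω, f (U t ω) ∂P) - ∫ y, f y ∂(wilsonMeasure (d := 3) (L := L) (fundamentalRep (Fin 2)) β')| ≤
            C * Real.exp (-c * t) := by
  classical
  haveI : IsProbabilityMeasure (wilsonMeasure (d := 3) (L := L) (fundamentalRep (Fin 2)) β') :=
    isProbabilityMeasure_wilsonMeasure (d := 3) (L := L) (fundamentalRep (Fin 2)) (continuous_fundamentalRep (Fin 2)) β'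
  haveI : Nonempty (GaugeConfig 3 L (Matrix.specialUnitaryGroup (Fin 2) ℂ)) := ⟨fun _ => 1⟩
  -- THE transition kernels, Chapman–Kolmogorov, Doeblin, invariance (all theorems of the tree)
  obtain ⟨κ, hκM, hκ0, hreal⟩ := exists_transitionKernel L β'
  haveI : ∀ t, IsMarkovKernel (κ t) := hκM
  have hadd : ∀ s t : ℝ≥0, κ (s + t) = κ t ∘ₖ κ s := chapmanKolmogorov_szz β' κ hreal
  obtain ⟨td, ν, hν0, hν⟩ := doeblin_szz (L := L) β' κ hreal
  have hinv : ∀ t, Kernel.Invariant (κ t) (wilsonMeasure (d := 3) (L := L) (fundamentalRep (Fin 2)) β') :=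
    fun t => wilson_invariant_of_fact L β' (wilsonMeasureLangevinInvariant_su2 L β') κ hreal t
  -- Harris with the Lyapunov function `V ≡ 1`
  have hminor : ∀ R : ℝ≥0, ∃ t_R : ℝ≥0, ∀ t : ℝ≥0, t_R ≤ t →
      ∃ ν' : Measure (GaugeConfig 3 L (Matrix.specialUnitaryGroup (Fin 2) ℂ)), ν' ≠ 0 ∧
        ∀ z, (fun _ => (1 : ℝ≥0)) z ≤ R → ν' ≤ κ t z := by
    intro R
    refine ⟨td, fun t ht => ⟨ν, hν0, fun z _ => ?_⟩⟩
    have ht' : κ t = κ td ∘ₖ κ (t - td) := by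
      rw [← hadd (t - td) td, tsub_add_cancel_of_le ht]
    rw [ht']
    exact le_comp_apply_of_forall_le hν z
  have hdrift : ∀ z, ∫⁻ y, ((fun _ => (1 : ℝ≥0)) y : ℝ≥0∞) ∂(κ 1 z) ≤
      ((2⁻¹ : ℝ≥0) : ℝ≥0∞) * (fun _ => (1 : ℝ≥0)) z + ((2⁻¹ : ℝ≥0) : ℝ≥0∞) := by
    intro z
    simp only [ENNReal.coe_one, lintegral_const, measure_univ, mul_one, ENNReal.coe_inv two_ne_zero,
      ENNReal.coe_ofNat, ENNReal.inv_two_add_inv_two, le_refl]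
  have hflow : ∀ (s : ℝ≥0) (x : GaugeConfig 3 L (Matrix.specialUnitaryGroup (Fin 2) ℂ)),
      ∫⁻ y, ((fun _ => (1 : ℝ≥0)) y : ℝ≥0∞) ∂(κ s x) ≤
        ENNReal.ofReal (Real.exp (0 * s)) * (fun _ => (1 : ℝ≥0)) x := by
    intro s x
    simp only [ENNReal.coe_one, lintegral_const, measure_univ, mul_one, zero_mul, Real.exp_zero,
      ENNReal.ofReal_one, le_refl]
  obtain ⟨C, c, hC, hc, hbound⟩ :=
    MarkovSemigroup.exp_convergence_of_drift_of_minorization κ hκ0 hadd (V := fun _ => (1 : ℝ≥0))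
      measurable_const (t₁ := 1) one_pos (a := 2⁻¹) (b₀ := 2⁻¹) (by norm_num) hdrift hminor
      (Cstar := 0) le_rfl hflow (wilsonMeasure (d := 3) (L := L) (fundamentalRep (Fin 2)) β') hinv
  refine ⟨C * 2, c, by positivity, hc, fun z t f hf hf1 Ω _ P _ W hW U hU0 hU => ?_⟩
  have hmUt : Measurable (U t) := (hU.adapted t).mono (hW.natFiltration.le t) le_rfl
  have hlaw := hreal t z Ω P W hW U hU0 hU
  have hint : ∫ ω, f (U t ω) ∂P = ∫ y, f y ∂(κ t z) := by
    rw [hlaw, integral_map hmUt.aemeasurable hf.aestronglyMeasurable]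
  rw [hint]
  have hb := hbound z t f hf (fun y => by simpa using hf1 y)
  have h2 : C * (1 + ((fun _ : GaugeConfig 3 L (Matrix.specialUnitaryGroup (Fin 2) ℂ) => (1 : ℝ≥0)) z : ℝ)) *
      Real.exp (-c * t) = C * 2 * Real.exp (-c * t) := by
    simp only [NNReal.coe_one]
    ring
  rw [h2] at hb
  exact hb

/-- **The same bound on the one-time laws**: with `C, c` of `exp_mixing_szz`, for every solution `U` from `z`,
`|∫ f d(law U_t) − ∫ f dμ_W| ≤ C e^{−ct}` for all measurable `|f| ≤ 1`, where `law U_t = P.map (U t)`. [folklore] -/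
theorem exp_mixing_szz_map (β' : ℝ) :
    ∃ C c : ℝ, 0 < C ∧ 0 < c ∧
      ∀ (z : GaugeConfig 3 L (Matrix.specialUnitaryGroup (Fin 2) ℂ)) (t : ℝ≥0)
        (f : GaugeConfig 3 L (Matrix.specialUnitaryGroup (Fin 2) ℂ) → ℝ), Measurable f → (∀ y, |f y| ≤ 1) →
        ∀ (Ω : Type) [MeasurableSpace Ω] (P : Measure Ω) [IsProbabilityMeasure P]
          (W : ℝ≥0 → Ω → (Edge 3 L × NoiseIdx 2 → ℝ)) (hW : IsFlatBrownian W P)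
          (U : ℝ≥0 → Ω → GaugeConfig 3 L (Matrix.specialUnitaryGroup (Fin 2) ℂ)),
          (∀ ω, U 0 ω = z) →
          (latticeLangevinDynamics (fundamentalLatticeRep 2) β').IsSolution (fundamentalRep (Fin 2))
            hW.natFiltration P W U →
          |(∫ y, f y ∂(P.map (U t))) - ∫ y, f y ∂(wilsonMeasure (d := 3) (L := L) (fundamentalRep (Fin 2)) β')| ≤
            C * Real.exp (-c * t) := by
  obtain ⟨C, c, hC, hc, h⟩ := exp_mixing_szz L β'
  refine ⟨C, c, hC, hc, fun z t f hf hf1 Ω _ P _ W hW U hU0 hU => ?_⟩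
  have hmUt : Measurable (U t) := (hU.adapted t).mono (hW.natFiltration.le t) le_rfl
  rw [integral_map hmUt.aemeasurable hf.aestronglyMeasurable]
  exact h z t f hf hf1 Ω P W hW U hU0 hU

end Summit.QuantumFields.YangMills.Theorems.ColdStartUniversality

end
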